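import Mathlib.Analysis.Complex.Periodic
import Mathlib.Analysis.Complex.Liouville
import Mathlib.Analysis.SpecialFunctions.Pow.Asymptotics
import Literature.Analysis.Complex.SchwarzReflection
import Literature.Analysis.Complex.PolynomialGrowthLiouville
import HarnessLib

/-!
# Double Schwarz reflection on a strip: the `2i`-periodic entire extension and its three modes

Tools for the rigidity theorem of `Literature/Analysis/Complex/StripPositivityRigidity.lean`
(a holomorphic function on the strip `{0 < im w < 1}` of exponential type `a < 2π` in `re w` with
non-negative real boundary values on both lines is constant):

* `differentiableOn_glue_line` — gluing two functions holomorphic on the two sides of a horizontal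
  line, continuous up to it and agreeing on it (Painlevé's theorem for a line, the tree's
  `Complex.differentiableOn_of_continuousOn_of_differentiableAt_off_im_ne`);
* `exists_reflection_real_axis` — Schwarz reflection of a function continuous on the closed strip
  `{0 ≤ im ≤ 1}`, holomorphic inside and real on `ℝ`, to `{-1 ≤ im ≤ 1}` (the tree's
  `Complex.schwarzReflection`, `Complex.differentiableOn_schwarzReflection`);
* `exists_periodic_extension` — a function continuous on `{-1 ≤ im ≤ 1}`, holomorphic inside, with
  matching values on the two boundary lines, extends to an entire `2i`-periodic function (translate
  and glue);
* `exists_three_modes_of_periodic` — an entire `2i`-periodic `E` with `‖E w‖ ≤ C e^{a|re w|}`,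
  `a < 2π`, is `c₁ e^{-πw} + c₂ + c₃ e^{πw}`: in the variable `q = e^{πw}` (Mathlib's
  `Function.Periodic.cuspFunction` for the real period `2` of `z ↦ E (iz)`), `q² E` has a removable
  singularity at `q = 0` and polynomial growth `|q|^{2 + a/π}`, `2 + a/π < 4`, at infinity, so it is a
  cubic polynomial vanishing at `0` (`exists_eq_sum_of_differentiable_of_growth`). This is the
  `a < 2π` companion of the tree's `apply_eq_apply_of_periodic_of_norm_le_exp`
  (`PeriodicEntireLiouville.lean`, type `< 2π/T` ⇒ constant), which covers only `a < π` here.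

References: Conway, *Functions of One Complex Variable I*, IX.1.1 (reflection); R. P. Boas,
*Entire Functions*, §6.10 (periodic entire functions of exponential type are trigonometric
polynomials). All statements are folklore.
-/

noncomputable section

namespace Literature.Analysis.Complex

open _root_.Complex Set Filter Metric Asymptotics
open scoped ComplexConjugate Topology Real

/-! ### Gluing along a horizontal line -/

/-- **Gluing along a horizontal line.** If `f` is continuous on `{y₀ ≤ im < y₀ + δ}` and holomorphic
inside, `g` is continuous on `{y₀ - δ < im ≤ y₀}` and holomorphic inside, and `f = g` on the line
`im = y₀`, then the glued function is holomorphic on the open strip `{y₀ - δ < im < y₀ + δ}`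
(Painlevé's theorem for a line, `Complex.differentiableOn_of_continuousOn_of_differentiableAt_off_im_ne`).
[folklore] -/
theorem differentiableOn_glue_line {f g : ℂ → ℂ} {y₀ δ : ℝ}
    (hfc : ContinuousOn f {w | y₀ ≤ w.im ∧ w.im < y₀ + δ})
    (hfd : DifferentiableOn ℂ f {w | y₀ < w.im ∧ w.im < y₀ + δ})
    (hgc : ContinuousOn g {w | y₀ - δ < w.im ∧ w.im ≤ y₀})
    (hgd : DifferentiableOn ℂ g {w | y₀ - δ < w.im ∧ w.im < y₀})
    (hfg : ∀ w : ℂ, w.im = y₀ → f w = g w) :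
    DifferentiableOn ℂ (fun w => if y₀ ≤ w.im then f w else g w)
      {w | y₀ - δ < w.im ∧ w.im < y₀ + δ} := by
  have hU : IsOpen {w : ℂ | y₀ - δ < w.im ∧ w.im < y₀ + δ} :=
    (isOpen_Ioo (a := y₀ - δ) (b := y₀ + δ)).preimage continuous_im
  refine Complex.differentiableOn_of_continuousOn_of_differentiableAt_off_im_ne hU y₀ ?_ ?_
  · apply ContinuousOn.if
    · rintro w ⟨-, hw⟩
      rw [frontier_setOf_le_im] at hw
      exact hfg w hw
    · have : closure {w : ℂ | y₀ ≤ w.im} = {w : ℂ | y₀ ≤ w.im} :=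
        (isClosed_le continuous_const continuous_im).closure_eq
      rw [this]
      exact hfc.mono fun w ⟨h1, h2⟩ => ⟨h2, h1.2⟩
    · have : closure {w : ℂ | ¬ y₀ ≤ w.im} = {w : ℂ | w.im ≤ y₀} := by
        simp only [not_le]
        exact closure_setOf_im_lt y₀
      rw [this]
      exact hgc.mono fun w ⟨h1, h2⟩ => ⟨h1.1, h2⟩
  · rintro w ⟨h1, h2⟩ hne
    rcases lt_or_gt_of_ne hne with hlt | hgt
    · have hev : (fun w => if y₀ ≤ w.im then f w else g w) =ᶠ[𝓝 w] g := by
        filter_upwards [(isOpen_lt continuous_im continuous_const).mem_nhds hlt] with v hv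
        simp [not_le.mpr (show v.im < y₀ from hv)]
      refine DifferentiableAt.congr_of_eventuallyEq ?_ hev
      exact hgd.differentiableAt
        (((isOpen_Ioo (a := y₀ - δ) (b := y₀)).preimage continuous_im).mem_nhds ⟨h1, hlt⟩)
    · have hev : (fun w => if y₀ ≤ w.im then f w else g w) =ᶠ[𝓝 w] f := by
        filter_upwards [(isOpen_lt continuous_const continuous_im).mem_nhds hgt] with v hv
        simp [le_of_lt (show y₀ < v.im from hv)]
      refine DifferentiableAt.congr_of_eventuallyEq ?_ hev
      exact hfd.differentiableAt
        (((isOpen_Ioo (a := y₀) (b := y₀ + δ)).preimage continuous_im).mem_nhds ⟨hgt, h2⟩)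

/-! ### Reflection across the real axis and periodisation -/

/-- **Schwarz reflection across the real axis (strip form).** A function continuous on the closed strip
`{0 ≤ im ≤ 1}`, holomorphic inside and real on the real axis extends (by `Complex.schwarzReflection`,
`w ↦ conj (u (conj w))` below the axis) to a function continuous on `{-1 ≤ im ≤ 1}`, holomorphic on
`{-1 < im < 1}` and commuting with `conj`. [cite: Conway1978, Ch. IX Thm. 1.1] -/
theorem exists_reflection_real_axis (u : ℂ → ℂ)
    (hd : DifferentiableOn ℂ u {w : ℂ | 0 < w.im ∧ w.im < 1})
    (hc : ContinuousOn u {w : ℂ | 0 ≤ w.im ∧ w.im ≤ 1})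
    (h0 : ∀ x : ℝ, (u x).im = 0) :
    ∃ U : ℂ → ℂ, (∀ w, 0 ≤ w.im → U w = u w) ∧ (∀ w, U (conj w) = conj (U w)) ∧
      ContinuousOn U {w : ℂ | -1 ≤ w.im ∧ w.im ≤ 1} ∧
      DifferentiableOn ℂ U {w : ℂ | -1 < w.im ∧ w.im < 1} := by
  have hreal : ∀ w : ℂ, w.im = 0 → conj (u w) = u w := by
    intro w hw
    have : w = (w.re : ℂ) := Complex.ext (by simp) (by simp [hw])
    rw [this, conj_eq_iff_im]
    exact h0 w.re
  refine ⟨schwarzReflection u, fun w hw => schwarzReflection_of_nonneg hw, ?_, ?_, ?_⟩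
  · intro w
    rcases lt_trichotomy w.im 0 with h | h | h
    · have h1 : (0:ℝ) ≤ (conj w).im := by rw [conj_im]; linarith
      rw [schwarzReflection_of_nonneg h1, schwarzReflection_of_neg h, Complex.conj_conj]
    · have hw : conj w = w := conj_eq_iff_im.mpr h
      rw [hw, schwarzReflection_of_nonneg h.symm.le, hreal w h]
    · have h1 : (conj w).im < 0 := by rw [conj_im]; linarith
      rw [schwarzReflection_of_neg h1, schwarzReflection_of_nonneg h.le, Complex.conj_conj]
  · apply ContinuousOn.if
    · rintro w ⟨-, hw⟩
      rw [frontier_setOf_le_im] at hw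
      rw [conj_eq_iff_im.mpr hw, hreal w hw]
    · have : closure {w : ℂ | 0 ≤ w.im} = {w : ℂ | 0 ≤ w.im} :=
        (isClosed_le continuous_const continuous_im).closure_eq
      rw [this]
      exact hc.mono fun w ⟨h1, h2⟩ => ⟨h2, h1.2⟩
    · have : closure {w : ℂ | ¬ 0 ≤ w.im} = {w : ℂ | w.im ≤ 0} := by
        simp only [not_le]; exact closure_setOf_im_lt 0
      rw [this]
      refine (continuous_conj.comp_continuousOn (hc.comp continuous_conj.continuousOn ?_))
      rintro w ⟨⟨h1, -⟩, h2⟩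
      exact ⟨by simpa using h2, by simp only [conj_im]; linarith⟩
  · have hU : IsOpen {w : ℂ | -1 < w.im ∧ w.im < 1} :=
      (isOpen_Ioo (a := (-1:ℝ)) (b := 1)).preimage continuous_im
    refine differentiableOn_schwarzReflection hU (fun z hz => ?_) ?_ ?_ (fun z _ hz => hreal z hz)
    · simp only [mem_setOf_eq, conj_im] at hz ⊢
      exact ⟨by linarith [hz.2], by linarith [hz.1]⟩
    · exact hc.mono fun w ⟨h1, h2⟩ => ⟨h2, h1.2.le⟩
    · exact hd.mono fun w ⟨h1, h2⟩ => ⟨h2, h1.2⟩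

/-- **Periodisation.** A function continuous on `{-1 ≤ im ≤ 1}`, holomorphic inside, whose values on the
line `im = 1` agree with those on `im = -1` (`U (w - 2i) = U w`), extends to an entire `2i`-periodic
function (translate by multiples of `2i` and glue the translates along the lines `im ≡ 1 (mod 2)`).
[folklore] -/
theorem exists_periodic_extension (U : ℂ → ℂ)
    (hc : ContinuousOn U {w : ℂ | -1 ≤ w.im ∧ w.im ≤ 1})
    (hd : DifferentiableOn ℂ U {w : ℂ | -1 < w.im ∧ w.im < 1})
    (hmatch : ∀ w : ℂ, w.im = 1 → U (w - 2 * I) = U w) :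
    ∃ E : ℂ → ℂ, Differentiable ℂ E ∧ (∀ w, E (w + 2 * I) = E w) ∧
      ∀ w, -1 ≤ w.im → w.im < 1 → E w = U w := by
  -- the shift `s w = 2 ⌊(im w + 1)/2⌋` brings `im w` into `[-1, 1)`
  let k : ℂ → ℤ := fun w => ⌊(w.im + 1) / 2⌋
  let E : ℂ → ℂ := fun w => U (w - ((2 * k w : ℝ) : ℂ) * I)
  have hk : ∀ w : ℂ, ∀ m : ℤ, k w = m ↔ (2 * m - 1 : ℝ) ≤ w.im ∧ w.im < 2 * m + 1 := by
    intro w m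
    simp only [k, Int.floor_eq_iff]
    constructor
    · rintro ⟨h1, h2⟩; constructor <;> linarith
    · rintro ⟨h1, h2⟩; constructor <;> linarith
  have hEk : ∀ w : ℂ, ∀ m : ℤ, k w = m → E w = U (w - ((2 * m : ℝ) : ℂ) * I) := by
    intro w m hm; simp only [E, hm]
  have hshift_im : ∀ (w : ℂ) (m : ℤ), (w - ((2 * m : ℝ) : ℂ) * I).im = w.im - 2 * m := by
    intro w m; simp
  refine ⟨E, ?_, ?_, ?_⟩
  · -- differentiability
    intro w₀
    set m : ℤ := k w₀ with hm
    have hm' := (hk w₀ m).mp rfl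
    rcases hm'.1.eq_or_lt with heq | hlt
    · -- seam point: `im w₀ = 2m - 1`; glue `U (· - 2mi)` (above) with `U (· - 2(m-1)i)` (below)
      set y₀ : ℝ := 2 * m - 1 with hy₀
      let f : ℂ → ℂ := fun w => U (w - ((2 * m : ℝ) : ℂ) * I)
      let g : ℂ → ℂ := fun w => U (w - ((2 * (m - 1 : ℤ) : ℝ) : ℂ) * I)
      have hfc : ContinuousOn f {w | y₀ ≤ w.im ∧ w.im < y₀ + 2} := by
        refine hc.comp (by fun_prop) ?_
        rintro w ⟨h1, h2⟩
        refine ⟨?_, ?_⟩ <;> · rw [hshift_im]; linarith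
      have hfd : DifferentiableOn ℂ f {w | y₀ < w.im ∧ w.im < y₀ + 2} := by
        refine hd.comp (by fun_prop) ?_
        rintro w ⟨h1, h2⟩
        refine ⟨?_, ?_⟩ <;> · rw [hshift_im]; linarith
      have hgc : ContinuousOn g {w | y₀ - 2 < w.im ∧ w.im ≤ y₀} := by
        refine hc.comp (by fun_prop) ?_
        rintro w ⟨h1, h2⟩
        refine ⟨?_, ?_⟩ <;> · rw [hshift_im]; push_cast at h1 h2 ⊢; linarith
      have hgd : DifferentiableOn ℂ g {w | y₀ - 2 < w.im ∧ w.im < y₀} := by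
        refine hd.comp (by fun_prop) ?_
        rintro w ⟨h1, h2⟩
        refine ⟨?_, ?_⟩ <;> · rw [hshift_im]; push_cast at h1 h2 ⊢; linarith
      have hfg : ∀ w : ℂ, w.im = y₀ → f w = g w := by
        intro w hw
        have h1 : (w - ((2 * (m - 1 : ℤ) : ℝ) : ℂ) * I).im = 1 := by
          rw [hshift_im, hw, hy₀]; push_cast; ring
        have := hmatch _ h1
        simp only [f, g]
        rw [← this]
        congr 1
        push_cast; ring
      have hG := differentiableOn_glue_line hfc hfd hgc hgd hfg
      have hw₀ : w₀ ∈ {w : ℂ | y₀ - 2 < w.im ∧ w.im < y₀ + 2} := ⟨by linarith, by linarith⟩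
      have hopen : IsOpen {w : ℂ | y₀ - 2 < w.im ∧ w.im < y₀ + 2} :=
        (isOpen_Ioo (a := y₀ - 2) (b := y₀ + 2)).preimage continuous_im
      have hGat := hG.differentiableAt (hopen.mem_nhds hw₀)
      refine (Filter.EventuallyEq.differentiableAt_iff ?_).mp hGat
      -- `E` agrees with the glued function near `w₀`
      have hnhds : {w : ℂ | y₀ - 1 < w.im ∧ w.im < y₀ + 1} ∈ 𝓝 w₀ :=
        ((isOpen_Ioo (a := y₀ - 1) (b := y₀ + 1)).preimage continuous_im).mem_nhds
          ⟨by linarith, by linarith⟩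
      filter_upwards [hnhds] with w hw
      rcases hw with ⟨hw1, hw2⟩
      by_cases hcase : y₀ ≤ w.im
      · rw [if_pos hcase]
        exact (hEk w m ((hk w m).mpr ⟨by linarith, by linarith⟩)).symm
      · rw [if_neg hcase]
        push Not at hcase
        exact (hEk w (m - 1) ((hk w (m - 1)).mpr
          ⟨by push_cast; linarith, by push_cast; linarith⟩)).symm
    · -- interior point: `k` is locally constant
      have hnhds : {w : ℂ | (2 * m - 1 : ℝ) < w.im ∧ w.im < 2 * m + 1} ∈ 𝓝 w₀ :=
        ((isOpen_Ioo (a := (2 * m - 1 : ℝ)) (b := 2 * m + 1)).preimage continuous_im).mem_nhds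
          ⟨hlt, hm'.2⟩
      have hloc : E =ᶠ[𝓝 w₀] fun w => U (w - ((2 * m : ℝ) : ℂ) * I) := by
        filter_upwards [hnhds] with w hw
        exact hEk w m ((hk w m).mpr ⟨hw.1.le, hw.2⟩)
      refine (Filter.EventuallyEq.differentiableAt_iff hloc).mpr ?_
      refine (hd.differentiableAt ?_).comp w₀ (by fun_prop)
      apply ((isOpen_Ioo (a := (-1:ℝ)) (b := 1)).preimage continuous_im).mem_nhds
      show -1 < (w₀ - ((2 * m : ℝ) : ℂ) * I).im ∧ (w₀ - ((2 * m : ℝ) : ℂ) * I).im < 1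
      rw [hshift_im]
      constructor <;> linarith [hm'.2]
  · -- periodicity
    intro w
    have hkw : k (w + 2 * I) = k w + 1 := by
      have := (hk w (k w)).mp rfl
      rw [hk]
      simp only [add_im, mul_im, I_re, I_im, re_ofNat, im_ofNat]
      push_cast
      constructor <;> linarith [this.1, this.2]
    rw [hEk _ _ hkw, hEk w (k w) rfl]
    congr 1
    push_cast
    ring
  · -- agreement on the fundamental strip
    intro w h1 h2
    rw [hEk w 0 ((hk w 0).mpr ⟨by push_cast; linarith, by push_cast; linarith⟩)]
    simp


/-! ### The three modes of a `2i`-periodic entire function of type `a < 2π` -/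

/-- **Three surviving modes.** An entire `2i`-periodic function with `‖E w‖ ≤ C e^{a |re w|}`, `a < 2π`,
is `c₁ e^{-πw} + c₂ + c₃ e^{πw}`: with `q = e^{πw}` (Mathlib's `Function.Periodic.cuspFunction` for the
real period `2` of `z ↦ E (iz)`), `q² E` is bounded near `q = 0`, hence extends to an entire function of
`q` vanishing at `0`, of polynomial growth `|q|^{2 + a/π}` with `2 + a/π < 4`, so it is a cubic
polynomial (`exists_eq_sum_of_differentiable_of_growth`). Boas, *Entire Functions*, §6.10. [folklore] -/
theorem exists_three_modes_of_periodic (E : ℂ → ℂ) (C a : ℝ) (ha : a < 2 * π)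
    (hE : Differentiable ℂ E) (hper : ∀ w, E (w + 2 * I) = E w)
    (hb : ∀ w, ‖E w‖ ≤ C * Real.exp (a * |w.re|)) :
    ∃ c₁ c₂ c₃ : ℂ, ∀ w, E w = c₁ * exp (-(π * w)) + c₂ + c₃ * exp (π * w) := by
  have hC : 0 ≤ C := by
    have := hb 0
    simp only [zero_re, abs_zero, mul_zero, Real.exp_zero, mul_one] at this
    exact (norm_nonneg _).trans this
  have hq2 : ∀ z : ℂ, Function.Periodic.qParam 2 z = exp (π * I * z) := by
    intro z; simp only [Function.Periodic.qParam]; congr 1; push_cast; ring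
  set g₂ : ℂ → ℂ := fun z => (Function.Periodic.qParam 2 z) ^ 2 * E (I * z) with hg₂
  have hper₂ : Function.Periodic g₂ ((2:ℝ) : ℂ) := by
    intro z
    simp only [hg₂, hq2]
    have h1 : exp (π * I * (z + (2:ℝ))) = exp (π * I * z) := by
      rw [show (π : ℂ) * I * (z + (2:ℝ)) = π * I * z + 2 * π * I by push_cast; ring, Complex.exp_add,
        Complex.exp_two_pi_mul_I, mul_one]
    have h2 : E (I * (z + (2:ℝ))) = E (I * z) := by
      rw [show I * (z + ((2:ℝ):ℂ)) = I * z + 2 * I by push_cast; ring, hper]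
    rw [h1, h2]
  have hdiff₂ : Differentiable ℂ g₂ :=
    ((Function.Periodic.differentiable_qParam (h := 2)).pow 2).mul
      (hE.comp (differentiable_id.const_mul I))
  have hnorm : ∀ z : ℂ, ‖g₂ z‖ ≤ Real.exp (-2 * π * z.im) * (C * Real.exp (a * |z.im|)) := by
    intro z
    have e1 : ‖Function.Periodic.qParam 2 z‖ ^ 2 = Real.exp (-2 * π * z.im) := by
      rw [hq2, Complex.norm_exp, ← Real.exp_nat_mul]
      congr 1
      simp; ring
    have e2 : ‖E (I * z)‖ ≤ C * Real.exp (a * |z.im|) := by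
      have := hb (I * z)
      simpa using this
    calc ‖g₂ z‖ = ‖Function.Periodic.qParam 2 z‖ ^ 2 * ‖E (I * z)‖ := by
          simp only [hg₂, norm_mul, norm_pow]
      _ ≤ Real.exp (-2 * π * z.im) * (C * Real.exp (a * |z.im|)) := by
          rw [e1]; exact mul_le_mul_of_nonneg_left e2 (Real.exp_pos _).le
  have hnorm' : ∀ z : ℂ, 0 ≤ z.im → ‖g₂ z‖ ≤ C * Real.exp ((a - 2 * π) * z.im) := by
    intro z hz
    refine (hnorm z).trans (le_of_eq ?_)
    rw [abs_of_nonneg hz, mul_left_comm, ← Real.exp_add]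
    congr 2; ring
  have hbdd : BoundedAtFilter (comap im atTop) g₂ := by
    rw [BoundedAtFilter, isBigO_iff]
    refine ⟨C, Filter.eventually_comap.mpr ((eventually_ge_atTop (0:ℝ)).mono fun y hy z hz => ?_)⟩
    simp only [Pi.one_apply, norm_one, mul_one]
    refine (hnorm' z (hz ▸ hy)).trans ?_
    have : Real.exp ((a - 2 * π) * z.im) ≤ 1 := by
      rw [Real.exp_le_one_iff]; rw [hz]; nlinarith
    nlinarith
  have hzero : ZeroAtFilter (comap im atTop) g₂ := by
    rw [ZeroAtFilter]
    have hlim : Tendsto (fun y : ℝ => C * Real.exp ((a - 2 * π) * y)) atTop (𝓝 0) := by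
      have := (Real.tendsto_exp_atBot.comp
        (tendsto_id.const_mul_atTop_of_neg (show a - 2 * π < 0 by linarith))).const_mul C
      simpa using this
    refine squeeze_zero_norm' ?_ (hlim.comp tendsto_comap)
    exact Filter.eventually_comap.mpr ((eventually_ge_atTop (0:ℝ)).mono fun y hy z hz => by
      simpa only [Function.comp_apply, hz] using hnorm' z (hz ▸ hy))
  set V : ℂ → ℂ := Function.Periodic.cuspFunction 2 g₂ with hV
  have hV0 : V 0 = 0 := Function.Periodic.cuspFunction_zero_of_zero_at_inf two_pos hzero
  have hVdiff : Differentiable ℂ V := by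
    intro q
    by_cases hq : q = 0
    · rw [hq]
      exact Function.Periodic.differentiableAt_cuspFunction_zero two_pos hper₂
        (Filter.Eventually.of_forall fun z => hdiff₂ z) hbdd
    · have := Function.Periodic.differentiableAt_cuspFunction (h := 2) two_ne_zero hper₂
        (hdiff₂ (Function.Periodic.invQParam 2 q))
      rwa [Function.Periodic.qParam_right_inv two_ne_zero hq] at this
  have hVb : ∀ q : ℂ, 1 ≤ ‖q‖ → ‖V q‖ ≤ C * ‖q‖ ^ (2 + a / π) := by
    intro q hq
    have hq0 : q ≠ 0 := by
      intro h; rw [h, norm_zero] at hq; exact absurd hq (by norm_num)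
    have hqpos : 0 < ‖q‖ := norm_pos_iff.mpr hq0
    set z := Function.Periodic.invQParam 2 q with hz
    have hVq : V q = q ^ 2 * E (I * z) := by
      rw [hV, Function.Periodic.cuspFunction_eq_of_nonzero _ _ hq0]
      simp only [hg₂]
      rw [Function.Periodic.qParam_right_inv two_ne_zero hq0]
    have him : z.im = -(Real.log ‖q‖) / π := by
      rw [hz, Function.Periodic.im_invQParam]; field_simp
    have hlog : 0 ≤ Real.log ‖q‖ := Real.log_nonneg hq
    have e2 : ‖E (I * z)‖ ≤ C * ‖q‖ ^ (a / π) := by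
      have := hb (I * z)
      simp only [mul_re, I_re, zero_mul, I_im, one_mul, zero_sub, abs_neg] at this
      rw [him, abs_div, abs_neg, abs_of_nonneg hlog, abs_of_pos Real.pi_pos] at this
      rw [Real.rpow_def_of_pos hqpos]
      convert this using 3
      ring
    rw [hVq, norm_mul, norm_pow, Real.rpow_add hqpos, Real.rpow_two]
    calc ‖q‖ ^ 2 * ‖E (I * z)‖ ≤ ‖q‖ ^ 2 * (C * ‖q‖ ^ (a / π)) :=
          mul_le_mul_of_nonneg_left e2 (by positivity)
      _ = C * (‖q‖ ^ 2 * ‖q‖ ^ (a / π)) := by ring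
  have ht : 2 + a / π < ((4:ℕ) : ℝ) := by
    have : a / π < 2 := by rw [div_lt_iff₀ Real.pi_pos]; linarith
    push_cast; linarith
  obtain ⟨c, hc⟩ := exists_eq_sum_of_differentiable_of_growth 4 V (2 + a / π) C ht hVdiff hVb
  have hc' : ∀ q, V q = c 0 + c 1 * q + c 2 * q ^ 2 + c 3 * q ^ 3 := by
    intro q; rw [hc q]; simp [Finset.sum_range_succ]
  have hc0 : c 0 = 0 := by
    have := hc' 0; rw [hV0] at this; simp at this; exact this.symm
  refine ⟨c 1, c 2, c 3, fun w => ?_⟩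
  have key := Function.Periodic.eq_cuspFunction (h := 2) two_ne_zero hper₂ (-I * w)
  rw [← hV] at key
  simp only [hg₂] at key
  have hQ : Function.Periodic.qParam 2 (-I * w) = exp (π * w) := by
    rw [hq2]; congr 1; ring_nf; rw [I_sq]; ring
  have hIw : I * (-I * w) = w := by ring_nf; rw [I_sq]; ring
  rw [hQ, hIw, hc', hc0] at key
  have hne : exp (π * w) ≠ 0 := exp_ne_zero _
  have hEw : E w = (c 1 * exp (π * w) + c 2 * exp (π * w) ^ 2 + c 3 * exp (π * w) ^ 3) /
      exp (π * w) ^ 2 := by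
    rw [eq_div_iff (pow_ne_zero 2 hne)]; linear_combination -key
  rw [hEw, Complex.exp_neg]
  field_simp

end Literature.Analysis.Complex
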